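/-
HONEST FRAMING: certified error envelopes and provably optimal rounding/accumulation schemes for
low-precision formats under stated cost models; every table by two implementations; no hardware
or vendor claims.
-/
import Summits.Ventures.CertifiedArithmetic.LowPrec.OptDemotionRoutingPairNode
import Summits.Ventures.CertifiedArithmetic.LowPrec.OptDemotionRoutingNodeRule

/-!
# The demotion law (Theorem T8), part 10k-a′: rows and options for LEMMA Φ3′ (and the popcount-3 e-side rows)

* `treeBR_gcB1_pair` — part 10i-0's single-bit gap convexity `x_{i+1} | x_{i+n}, x_i` scaled by
  `2·2^i` (the shape in which opt's LEMMA B1 uses it): `(2 - 2·2^-n) BR{0,-(i+1)} ≤ BR{0,-(i+n)} +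
  (1 - 2·2^-n) BR{0,-i}`;
* `treeBR_gcB1_triple` — the same with one fixed bit `-s` above the moving range (part 10d
  `treeBR_gap_convex` with `S = {0,-s}`): the row of the two-bit LEMMA B1 and of the hard branch of
  LEMMA Φ3′;
* `phi3p_optP3` — the five options of the four-bit coordinate `x_(s,c,c+j)` at a node used by the
  certificate of LEMMA Φ3′ (part 10k-0 `injected_le_treeBR_node` at
  `P = T, {-c,-(c+j)}, {-(c+j)}, {-s}, {-s,-(c+j)}`, shifted to top-normalised coordinates).
-/

namespace Summit.Ventures.CertifiedArithmetic.LowPrec.Opt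

open Literature.ComputerArithmetic.JeannerodRump2018
open Literature.ComputerArithmetic.JeannerodRump2018.SumTree

section Phi3pOpt

variable {q : ℕ}

/-- SCALED GAP CONVEXITY ON SINGLE-BIT COORDINATES (the shape of opt's LEMMA B1): for `1 ≤ i`,
`2 ≤ n`, `i + n ≤ q - 1`: `(2 - 2·2^-n) BR{0,-(i+1)} ≤ BR{0,-(i+n)} + (1 - 2·2^-n) BR{0,-i}`
(part 10i-0 `treeBR_gc_pair` multiplied by `2·2^i`). -/
theorem treeBR_gcB1_pair (X : SumTree) {i n : ℕ} (hi : 1 ≤ i) (hn : 2 ≤ n) (hinq : i + n + 1 ≤ q) :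
    0 ≤ (-2 + 2 * (2 : ℚ) ^ (-(n : ℤ))) * treeBR q X {0, -((i : ℤ) + 1)} + (1) * treeBR q X {0, -((i : ℤ) + n)} +
      (1 - 2 * (2 : ℚ) ^ (-(n : ℤ))) * treeBR q X {0, -(i : ℤ)} := by
  have pw : ∀ a b : ℤ, (2 : ℚ) ^ a * (2 : ℚ) ^ b = (2 : ℚ) ^ (a + b) := fun a b =>
    (zpow_add₀ (by norm_num) a b).symm
  have h := treeBR_gc_pair (q := q) X (j := i + n) (c := i) hi (by omega) (by omega)
  have e0 : ({0, -((i + n : ℕ) : ℤ)} : Finset ℤ) = {0, -((i : ℤ) + n)} := by push_cast; rfl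
  have w0 : (0 : ℚ) < (2 : ℚ) ^ (-(i : ℤ)) := zpow_pos (by norm_num) _
  have e1 : (2 : ℚ) ^ (-((i + n : ℕ) : ℤ)) = (2 : ℚ) ^ (-(i : ℤ)) * (2 : ℚ) ^ (-(n : ℤ)) := by
    rw [pw]; congr 1; push_cast; ring
  have e2 : (2 : ℚ) ^ (-((i : ℤ) + 1)) = (2 : ℚ) ^ (-(i : ℤ)) * (1 / 2) := by
    rw [show (1 / 2 : ℚ) = (2 : ℚ) ^ (-1 : ℤ) by norm_num, pw]; congr 1; ring
  rw [e0, e1, e2] at h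
  set w := (2 : ℚ) ^ (-(i : ℤ)) with hw
  have h' : w * ((2 - 2 * (2 : ℚ) ^ (-(n : ℤ))) * treeBR q X {0, -((i : ℤ) + 1)}) ≤
      w * (treeBR q X {0, -((i : ℤ) + n)} + (1 - 2 * (2 : ℚ) ^ (-(n : ℤ))) * treeBR q X {0, -(i : ℤ)}) := by
    nlinarith [h, w0]
  have := le_of_mul_le_mul_left h' w0
  linarith only [this]

/-- SCALED GAP CONVEXITY WITH ONE FIXED BIT (the shape of the two-bit LEMMA B1): for `1 ≤ s < i`,
`2 ≤ n`, `i + n ≤ q - 1`: `(2 - 2·2^-n) BR{0,-s,-(i+1)} ≤ BR{0,-s,-(i+n)} + (1 - 2·2^-n) BR{0,-s,-i}`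
(part 10d `treeBR_gap_convex` with `S = {0,-s}`, positions in one gap below `-s`). -/
theorem treeBR_gcB1_triple (X : SumTree) {s i n : ℕ} (hs : 1 ≤ s) (hsi : s < i) (hn : 2 ≤ n) (hinq : i + n + 1 ≤ q) :
    0 ≤ (-2 + 2 * (2 : ℚ) ^ (-(n : ℤ))) * treeBR q X {0, -(s : ℤ), -((i : ℤ) + 1)} +
      (1) * treeBR q X {0, -(s : ℤ), -((i : ℤ) + n)} + (1 - 2 * (2 : ℚ) ^ (-(n : ℤ))) * treeBR q X {0, -(s : ℤ), -(i : ℤ)} := by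
  have pw : ∀ a b : ℤ, (2 : ℚ) ^ a * (2 : ℚ) ^ b = (2 : ℚ) ^ (a + b) := fun a b =>
    (zpow_add₀ (by norm_num) a b).symm
  have rS : ∀ e : ℤ, e < -(s : ℤ) → 1 - (q : ℤ) ≤ e → Routable q (insert e ({0, -(s : ℤ)} : Finset ℤ)) := by
    intro e he heq x hx y hy
    simp only [Finset.mem_insert, Finset.mem_singleton] at hx hy
    rcases hx with rfl | rfl | rfl <;> rcases hy with rfl | rfl | rfl <;> omega
  have h := treeBR_gap_convex (q := q) X (S := ({0, -(s : ℤ)} : Finset ℤ)) (m₁ := -((i : ℤ) + n))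
    (m₂ := -((i : ℤ) + 1)) (m₃ := -(i : ℤ)) (by omega) (by omega)
    (by simp only [Finset.mem_insert, Finset.mem_singleton]; omega)
    (by simp only [Finset.mem_insert, Finset.mem_singleton]; omega)
    (by simp only [Finset.mem_insert, Finset.mem_singleton]; omega)
    (by intro x hx; simp only [Finset.mem_insert, Finset.mem_singleton] at hx; omega)
    (rS _ (by omega) (by omega)) (rS _ (by omega) (by omega)) (rS _ (by omega) (by omega))
  have e1 : insert (-((i : ℤ) + 1)) ({0, -(s : ℤ)} : Finset ℤ) = {0, -(s : ℤ), -((i : ℤ) + 1)} := by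
    ext z; simp only [Finset.mem_insert, Finset.mem_singleton]; omega
  have e2 : insert (-((i : ℤ) + n)) ({0, -(s : ℤ)} : Finset ℤ) = {0, -(s : ℤ), -((i : ℤ) + n)} := by
    ext z; simp only [Finset.mem_insert, Finset.mem_singleton]; omega
  have e3 : insert (-(i : ℤ)) ({0, -(s : ℤ)} : Finset ℤ) = {0, -(s : ℤ), -(i : ℤ)} := by
    ext z; simp only [Finset.mem_insert, Finset.mem_singleton]; omega
  have w0 : (0 : ℚ) < (2 : ℚ) ^ (-(i : ℤ)) := zpow_pos (by norm_num) _
  have p1 : (2 : ℚ) ^ (-((i : ℤ) + n)) = (2 : ℚ) ^ (-(i : ℤ)) * (2 : ℚ) ^ (-(n : ℤ)) := by rw [pw]; congr 1; ring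
  have p2 : (2 : ℚ) ^ (-((i : ℤ) + 1)) = (2 : ℚ) ^ (-(i : ℤ)) * (1 / 2) := by
    rw [show (1 / 2 : ℚ) = (2 : ℚ) ^ (-1 : ℤ) by norm_num, pw]; congr 1; ring
  rw [e1, e2, e3, p1, p2] at h
  set w := (2 : ℚ) ^ (-(i : ℤ)) with hw
  have h' : w * ((2 - 2 * (2 : ℚ) ^ (-(n : ℤ))) * treeBR q X {0, -(s : ℤ), -((i : ℤ) + 1)}) ≤
      w * (treeBR q X {0, -(s : ℤ), -((i : ℤ) + n)} + (1 - 2 * (2 : ℚ) ^ (-(n : ℤ))) * treeBR q X {0, -(s : ℤ), -(i : ℤ)}) := by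
    nlinarith [h, w0]
  have := le_of_mul_le_mul_left h' w0
  linarith only [this]

/-- The options of the four-bit right-hand coordinate `x_(s,c,c+j)` of LEMMA Φ3′ used by the
certificate (part 10k-0 `injected_le_treeBR_node` at `P = T, {-c,-(c+j)}, {-(c+j)}, {-s}, {-s,-(c+j)}`). -/
theorem phi3p_optP3 (hq1 : 1 ≤ q) {s c j k dl : ℕ} (hs1 : 1 ≤ s) (hsc : s + 1 ≤ c) (hj : 1 ≤ j)
    (hcjq : c + j + 1 ≤ q) (hck : (c : ℤ) + k = q) (hdl : (dl : ℤ) = (c : ℤ) - s) (A B : SumTree) :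
    let N := treeBR q (.node A B) {0, -(s : ℤ), -(c : ℤ), -((c : ℤ) + j)}
    1 + ((1) * treeBR q A {0, -(s : ℤ), -(c : ℤ), -((c : ℤ) + j)} + ((2 : ℚ) ^ (-(q : ℤ))) * treeBR q B {0}) ≤ N ∧
    1 + ((1) * treeBR q A {0, -(c : ℤ), -((c : ℤ) + j)} + ((2 : ℚ) ^ (-(s : ℤ))) * treeBR q B {0, -((dl : ℤ) + k)}) ≤ N ∧
    1 + ((1) * treeBR q A {0, -((c : ℤ) + j)} + ((2 : ℚ) ^ (-(s : ℤ))) * treeBR q B {0, -(dl : ℤ), -((dl : ℤ) + k)}) ≤ N ∧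
    ((2 : ℚ) ^ (-(k : ℤ))) + (((2 : ℚ) ^ (-(k : ℤ))) * treeBR q A {0, -(s : ℤ)} + ((2 : ℚ) ^ (-(q : ℤ))) * treeBR q B {0, -(j : ℤ), -(k : ℤ)}) ≤
      ((2 : ℚ) ^ (-(k : ℤ))) * N ∧
    ((2 : ℚ) ^ (-(k : ℤ))) + (((2 : ℚ) ^ (-(k : ℤ))) * treeBR q A {0, -(s : ℤ), -((c : ℤ) + j)} + ((2 : ℚ) ^ (-(q : ℤ))) * treeBR q B {0, -(k : ℤ)}) ≤
      ((2 : ℚ) ^ (-(k : ℤ))) * N := by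
  intro N
  have pw : ∀ a b : ℤ, (2 : ℚ) ^ a * (2 : ℚ) ^ b = (2 : ℚ) ^ (a + b) := fun a b =>
    (zpow_add₀ (by norm_num) a b).symm
  have hm0 : (0 : ℚ) < (2 : ℚ) ^ (-(k : ℤ)) := zpow_pos (by norm_num) _
  have hcm : (2 : ℚ) ^ (-(k : ℤ)) * (2 : ℚ) ^ (-(c : ℤ)) = (2 : ℚ) ^ (-(q : ℤ)) := by rw [pw]; congr 1; omega
  have hT : ∀ z ∈ ({-(s : ℤ), -(c : ℤ), -((c : ℤ) + j)} : Finset ℤ), 1 - (q : ℤ) ≤ z ∧ z ≤ -1 := by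
    intro z hz; simp only [Finset.mem_insert, Finset.mem_singleton] at hz; omega
  have key := fun (P : Finset ℤ) (hP : P ⊆ ({-(s : ℤ), -(c : ℤ), -((c : ℤ) + j)} : Finset ℤ)) =>
    injected_le_treeBR_node (q := q) hq1 A B hT hP
  refine ⟨?_, ?_, ?_, ?_, ?_⟩
  · have h := key {-(s : ℤ), -(c : ℤ), -((c : ℤ) + j)} (fun z hz => hz)
    have e1 : insert (-(q : ℤ)) (({-(s : ℤ), -(c : ℤ), -((c : ℤ) + j)} : Finset ℤ) \ {-(s : ℤ), -(c : ℤ), -((c : ℤ) + j)}) = {-(q : ℤ)} := by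
      rw [Finset.sdiff_self]; rfl
    rw [e1, treeBR_single_shift] at h
    linarith only [h]
  · have h := key {-(c : ℤ), -((c : ℤ) + j)} (by intro z hz; simp only [Finset.mem_insert, Finset.mem_singleton] at hz ⊢; omega)
    have e1 : insert (-(q : ℤ)) (({-(s : ℤ), -(c : ℤ), -((c : ℤ) + j)} : Finset ℤ) \ {-(c : ℤ), -((c : ℤ) + j)}) = {-(s : ℤ), -(q : ℤ)} := by
      ext z; simp only [Finset.mem_insert, Finset.mem_sdiff, Finset.mem_singleton]; omega
    have e2 : treeBR q B {-(s : ℤ), -(q : ℤ)} = (2 : ℚ) ^ (-(s : ℤ)) * treeBR q B {0, -((dl : ℤ) + k)} := by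
      rw [← treeBR_pair_shift B (-(s : ℤ)) (-((dl : ℤ) + k))]; congr 1; ext z; simp; omega
    have e3 : (insert (0 : ℤ) ({-(c : ℤ), -((c : ℤ) + j)} : Finset ℤ)) = {0, -(c : ℤ), -((c : ℤ) + j)} := rfl
    rw [e1, e2, e3] at h
    linarith only [h]
  · have h := key {-((c : ℤ) + j)} (by intro z hz; simp only [Finset.mem_insert, Finset.mem_singleton] at hz ⊢; omega)
    have e1 : insert (-(q : ℤ)) (({-(s : ℤ), -(c : ℤ), -((c : ℤ) + j)} : Finset ℤ) \ {-((c : ℤ) + j)}) = {-(s : ℤ), -(c : ℤ), -(q : ℤ)} := by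
      ext z; simp only [Finset.mem_insert, Finset.mem_sdiff, Finset.mem_singleton]; omega
    have e2 : treeBR q B {-(s : ℤ), -(c : ℤ), -(q : ℤ)} = (2 : ℚ) ^ (-(s : ℤ)) * treeBR q B {0, -(dl : ℤ), -((dl : ℤ) + k)} := by
      rw [← treeBR_triple_shift B (-(s : ℤ)) (-(dl : ℤ)) (-((dl : ℤ) + k))]; congr 1; ext z; simp; omega
    have e3 : (insert (0 : ℤ) ({-((c : ℤ) + j)} : Finset ℤ)) = {0, -((c : ℤ) + j)} := rfl
    rw [e1, e2, e3] at h
    linarith only [h]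
  · have h := key {-(s : ℤ)} (by intro z hz; simp only [Finset.mem_insert, Finset.mem_singleton] at hz ⊢; omega)
    have e1 : insert (-(q : ℤ)) (({-(s : ℤ), -(c : ℤ), -((c : ℤ) + j)} : Finset ℤ) \ {-(s : ℤ)}) = {-(c : ℤ), -((c : ℤ) + j), -(q : ℤ)} := by
      ext z; simp only [Finset.mem_insert, Finset.mem_sdiff, Finset.mem_singleton]; omega
    have e2 : treeBR q B {-(c : ℤ), -((c : ℤ) + j), -(q : ℤ)} = (2 : ℚ) ^ (-(c : ℤ)) * treeBR q B {0, -(j : ℤ), -(k : ℤ)} := by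
      rw [← treeBR_triple_shift B (-(c : ℤ)) (-(j : ℤ)) (-(k : ℤ))]; congr 1; ext z; simp; omega
    have e3 : (insert (0 : ℤ) ({-(s : ℤ)} : Finset ℤ)) = {0, -(s : ℤ)} := rfl
    rw [e1, e2, e3] at h
    have h' := mul_le_mul_of_nonneg_left h hm0.le
    have e4 : (2 : ℚ) ^ (-(k : ℤ)) * (1 + (treeBR q A {0, -(s : ℤ)} + (2 : ℚ) ^ (-(c : ℤ)) * treeBR q B {0, -(j : ℤ), -(k : ℤ)})) =
        (2 : ℚ) ^ (-(k : ℤ)) + ((2 : ℚ) ^ (-(k : ℤ)) * treeBR q A {0, -(s : ℤ)} +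
          ((2 : ℚ) ^ (-(k : ℤ)) * (2 : ℚ) ^ (-(c : ℤ))) * treeBR q B {0, -(j : ℤ), -(k : ℤ)}) := by ring
    rw [e4, hcm] at h'
    linarith only [h']
  · have h := key {-(s : ℤ), -((c : ℤ) + j)} (by intro z hz; simp only [Finset.mem_insert, Finset.mem_singleton] at hz ⊢; omega)
    have e1 : insert (-(q : ℤ)) (({-(s : ℤ), -(c : ℤ), -((c : ℤ) + j)} : Finset ℤ) \ {-(s : ℤ), -((c : ℤ) + j)}) = {-(c : ℤ), -(q : ℤ)} := by
      ext z; simp only [Finset.mem_insert, Finset.mem_sdiff, Finset.mem_singleton]; omega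
    have e2 : treeBR q B {-(c : ℤ), -(q : ℤ)} = (2 : ℚ) ^ (-(c : ℤ)) * treeBR q B {0, -(k : ℤ)} := by
      rw [← treeBR_pair_shift B (-(c : ℤ)) (-(k : ℤ))]; congr 1; ext z; simp; omega
    have e3 : (insert (0 : ℤ) ({-(s : ℤ), -((c : ℤ) + j)} : Finset ℤ)) = {0, -(s : ℤ), -((c : ℤ) + j)} := rfl
    rw [e1, e2, e3] at h
    have h' := mul_le_mul_of_nonneg_left h hm0.le
    have e4 : (2 : ℚ) ^ (-(k : ℤ)) * (1 + (treeBR q A {0, -(s : ℤ), -((c : ℤ) + j)} + (2 : ℚ) ^ (-(c : ℤ)) * treeBR q B {0, -(k : ℤ)})) =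
        (2 : ℚ) ^ (-(k : ℤ)) + ((2 : ℚ) ^ (-(k : ℤ)) * treeBR q A {0, -(s : ℤ), -((c : ℤ) + j)} +
          ((2 : ℚ) ^ (-(k : ℤ)) * (2 : ℚ) ^ (-(c : ℤ))) * treeBR q B {0, -(k : ℤ)}) := by ring
    rw [e4, hcm] at h'
    linarith only [h']

end Phi3pOpt

end Summit.Ventures.CertifiedArithmetic.LowPrec.Opt
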